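import Summits.HodgeConjecture.HodgeConjecture.Theorems.Ring2WeilCoverageCMFieldNormResidueSymbolsRationalPrimes
import Summits.HodgeConjecture.HodgeConjecture.Theorems.Ring2WeilCoverageCMFieldNormResidueSymbolsDegreeOnePlaces
import Mathlib.NumberTheory.RamificationInertia.Valuation
import Mathlib.RingTheory.Ideal.Int
import HarnessLib

/-!
# Ring 2 — Weil-family coverage, CM-field rows: rational numbers at the places of a number field, the places of a
  QUADRATIC field over one rational prime, and the residues of `θ` at two degree-one places — toolkit for «which rows
  `W_{2k}.E.T` have a rational member» (WEIL-FAMILY-COVERAGE «## b03», cell (xxi′)(a), part 32)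

research route conditional on HC_CM; not a corollary; Q11.4-sentence-2 already refuted in dim ≥ 3.

The rows of the census table of a quartic CM field `E = F(√θ)` over Deligne's carrier `R` (`F = ℚ[S]/(R) = ℚ(θ)`) are
the classes `δ ∈ F^×/Nm_{E/F}(E^×)`, labelled by the finite even sets `T(δ)` of places of `F` where `(δ, θ)_𝔭 = -1`
(parts 1–11) [cite: Deligne1982HodgeCycles, §4 (1), Prop. 4.1, Cor. 4.2]; a row has a RATIONAL member iff `T = T(c)` for
some `c ∈ ℚ^×`.  The sequel (part 33) proves that `T(c)` is constant on the fibres of `Spec 𝓞_F → Spec ℤ`; this file is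
its number-field toolkit, for an arbitrary number field `K` unless said otherwise [folklore]:

* §84 a place `v ∋ ℓ` lies over `(ℓ)`; the valuation of a RATIONAL number at `v ∣ ℓ` only depends on the ramification
  index: `|c|_v = |c|_ℓ^{e(v|ℓ)}` (Mathlib `valuation_liesOver`) — two places over `ℓ` with the same `e` give a rational
  number the same valuation, a place with EVEN `e` gives it an even one.
* §85 (`[K:ℚ] = 2`) two DISTINCT places `v ≠ v'` over `ℓ` have `(ℓ) = v·v'`, norm `ℓ` and `e = 1`; a place `v ∋ p` with
  `(p, π)² = (p)` has `e = 2`; a place `v ∋ ℓ` of norm `ℓ²` is `(ℓ)` with `ord_v ℓ = 1`, `e = 1` (norm bookkeeping: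
  `N v ∈ {ℓ, ℓ²}`, `N((ℓ)) = ℓ²`, part 13).
* §85b `(n : 𝓞 K) ∈ v ⟺ ℓ ∣ n`; at a place of prime norm every algebraic integer is congruent to a rational integer; and
  **the residue symmetry for `θθ' = s₀²`** (the CYCLIC quartic CM fields, `q ∈ 𝓞_F²`): at two degree-one places
  `v, v' ∋ ℓ ∤ q`, `θ` is a square mod `v` iff mod `v'` (an integer representative of `θ mod v'` is a root of `R̄`, so
  `≡ θ` or `≡ θ'` mod `v`, and `θ̄·θ̄'` is a non-zero square).

No new definition, no named fact, no sorry; nothing about the Hodge conjecture is asserted.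
-/

noncomputable section

set_option linter.dupNamespace false

open Polynomial NumberField IsDedekindDomain

namespace Summit.HodgeConjecture.HodgeConjecture.Ring2.WeilCoverageCM

open Literature.AlgebraicGeometry.Deligne1982
open Literature.AlgebraicGeometry.HodgeTheory (splitDiscriminantClassCM)
open Literature.NumberTheory.QuadraticForms

section Toolkit

variable {K : Type*} [Field K] [NumberField K]

/-! ### §84 Rational numbers at the finite places of a number field -/

omit [NumberField K] in
/-- **A place `v ∋ ℓ` lies over the rational prime `(ℓ)`** (`v ∩ ℤ` is a proper ideal containing the maximal ideal
`(ℓ)`). [folklore] -/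
theorem liesOver_span_of_natCast_mem {ℓ : ℕ} (hℓ : ℓ.Prime) (v : HeightOneSpectrum (𝓞 K))
    (hv : (ℓ : 𝓞 K) ∈ v.asIdeal) : v.asIdeal.LiesOver (Ideal.span {(ℓ : ℤ)}) := by
  haveI : Fact ℓ.Prime := ⟨hℓ⟩
  refine ⟨((Int.ideal_span_isMaximal_of_prime ℓ).eq_of_le ?_ ?_)⟩
  · exact Ideal.IsPrime.ne_top inferInstance
  · rw [Ideal.span_singleton_le_iff_mem, Ideal.under_def, Ideal.mem_comap, map_natCast]
    exact hv

/-- **`|c|_v = |c|_ℓ^{e(v|ℓ)}` ⟹ two places over `ℓ` with the SAME ramification index give a rational number the same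
valuation.** [folklore] -/
theorem valuation_ratCast_eq_of_ramificationIdx_eq {ℓ : ℕ} (hℓ : ℓ.Prime) (v v' : HeightOneSpectrum (𝓞 K))
    [v.asIdeal.LiesOver (Ideal.span {(ℓ : ℤ)})] [v'.asIdeal.LiesOver (Ideal.span {(ℓ : ℤ)})]
    (he : (Ideal.span {(ℓ : ℤ)}).ramificationIdx' v.asIdeal = (Ideal.span {(ℓ : ℤ)}).ramificationIdx' v'.asIdeal)
    (c : ℚ) : v.valuation K (c : K) = v'.valuation K (c : K) := by
  have hℓ0 : (ℓ : ℤ) ≠ 0 := by exact_mod_cast hℓ.ne_zero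
  have hprime : (Ideal.span {(ℓ : ℤ)}).IsPrime :=
    (Ideal.span_singleton_prime hℓ0).2 (Nat.prime_iff_prime_int.1 hℓ)
  let v₀ : HeightOneSpectrum ℤ := ⟨Ideal.span {(ℓ : ℤ)}, hprime, by simpa using hℓ0⟩
  haveI : v.asIdeal.LiesOver v₀.asIdeal := ‹v.asIdeal.LiesOver (Ideal.span {(ℓ : ℤ)})›
  haveI : v'.asIdeal.LiesOver v₀.asIdeal := ‹v'.asIdeal.LiesOver (Ideal.span {(ℓ : ℤ)})›
  have e1 := HeightOneSpectrum.valuation_liesOver K v₀ v c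
  have e2 := HeightOneSpectrum.valuation_liesOver K v₀ v' c
  rw [show v₀.asIdeal.ramificationIdx' v.asIdeal = v₀.asIdeal.ramificationIdx' v'.asIdeal from he, e2,
    show algebraMap ℚ K c = (c : K) from eq_ratCast _ c] at e1
  exact e1.symm

/-- **A place with EVEN ramification index over `ℚ` gives every non-zero rational number an EVEN valuation**
(`|c|_v = |c|_ℓ^{e}`). [folklore] -/
theorem even_log_valuation_ratCast_of_even_ramificationIdx {ℓ : ℕ} (hℓ : ℓ.Prime) (v : HeightOneSpectrum (𝓞 K))
    [v.asIdeal.LiesOver (Ideal.span {(ℓ : ℤ)})] (he : Even ((Ideal.span {(ℓ : ℤ)}).ramificationIdx' v.asIdeal))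
    {c : ℚ} (hc : c ≠ 0) : Even (WithZero.log (v.valuation K (c : K))) := by
  have hℓ0 : (ℓ : ℤ) ≠ 0 := by exact_mod_cast hℓ.ne_zero
  have hprime : (Ideal.span {(ℓ : ℤ)}).IsPrime :=
    (Ideal.span_singleton_prime hℓ0).2 (Nat.prime_iff_prime_int.1 hℓ)
  let v₀ : HeightOneSpectrum ℤ := ⟨Ideal.span {(ℓ : ℤ)}, hprime, by simpa using hℓ0⟩
  haveI : v.asIdeal.LiesOver v₀.asIdeal := ‹v.asIdeal.LiesOver (Ideal.span {(ℓ : ℤ)})›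
  have e1 := HeightOneSpectrum.valuation_liesOver K v₀ v c
  rw [show algebraMap ℚ K c = (c : K) from eq_ratCast _ c] at e1
  obtain ⟨m, hm⟩ := he
  have h0 : v₀.valuation ℚ c ≠ 0 := (Valuation.ne_zero_iff _).2 hc
  rw [← e1, show v₀.asIdeal.ramificationIdx' v.asIdeal = m + m from hm, WithZero.log_pow, nsmul_eq_mul]
  exact ⟨(m : ℤ) * WithZero.log (v₀.valuation ℚ c), by push_cast; ring⟩

/-! ### §85 Quadratic fields: two distinct places over one rational prime -/

/-- **In a QUADRATIC field, two distinct places `v ≠ v'` over the same rational prime `ℓ` satisfy `(ℓ) = v·v'`**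
(`(ℓ) ⊆ v ∩ v' = v v'`, and norms `ℓ² = N v · N v' · N J` with `N v, N v' > 1`). [folklore] -/
theorem span_natCast_eq_mul_of_ne (hK : Module.finrank ℚ K = 2) {ℓ : ℕ} (hℓ : ℓ.Prime)
    (v v' : HeightOneSpectrum (𝓞 K)) (hne : v ≠ v') (hv : (ℓ : 𝓞 K) ∈ v.asIdeal) (hv' : (ℓ : 𝓞 K) ∈ v'.asIdeal) :
    Ideal.span {(ℓ : 𝓞 K)} = v.asIdeal * v'.asIdeal ∧ Ideal.absNorm v.asIdeal = ℓ := by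
  have hne' : v.asIdeal ≠ v'.asIdeal := fun h ↦ hne (HeightOneSpectrum.ext h)
  have hcop : v.asIdeal ⊔ v'.asIdeal = ⊤ := Ideal.IsMaximal.coprime_of_ne v.isMaximal v'.isMaximal hne'
  have hle : Ideal.span {(ℓ : 𝓞 K)} ≤ v.asIdeal * v'.asIdeal := by
    rw [Ideal.mul_eq_inf_of_coprime hcop]
    exact le_inf ((Ideal.span_singleton_le_iff_mem _).2 hv) ((Ideal.span_singleton_le_iff_mem _).2 hv')
  obtain ⟨J, hJ⟩ := Ideal.dvd_iff_le.2 hle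
  have hN := congrArg Ideal.absNorm hJ
  rw [absNorm_span_natCast, hK, map_mul, map_mul] at hN
  have h1 := absNorm_asIdeal_ne_one v
  have h1' := absNorm_asIdeal_ne_one v'
  have hℓ1 : 1 < ℓ := hℓ.one_lt
  rcases absNorm_eq_or_eq_sq_of_natCast_mem hK v hℓ hv with hNv | hNv <;>
    rcases absNorm_eq_or_eq_sq_of_natCast_mem hK v' hℓ hv' with hNv' | hNv' <;> rw [hNv, hNv'] at hN
  · -- `ℓ² = ℓ·ℓ·N J` ⟹ `N J = 1` ⟹ `J = ⊤`
    have hJ1 : Ideal.absNorm J = 1 := by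
      have h : ℓ ^ 2 * Ideal.absNorm J = ℓ ^ 2 * 1 := by
        calc ℓ ^ 2 * Ideal.absNorm J = ℓ * ℓ * Ideal.absNorm J := by ring
          _ = ℓ ^ 2 := hN.symm
          _ = ℓ ^ 2 * 1 := (mul_one _).symm
      exact Nat.eq_of_mul_eq_mul_left (by positivity) h
    refine ⟨?_, hNv⟩
    rw [hJ, Ideal.absNorm_eq_one_iff.1 hJ1, Ideal.mul_top]
  · exfalso
    have h : ℓ ^ 2 * (ℓ * Ideal.absNorm J) = ℓ ^ 2 * 1 := by
      calc ℓ ^ 2 * (ℓ * Ideal.absNorm J) = ℓ * ℓ ^ 2 * Ideal.absNorm J := by ring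
        _ = ℓ ^ 2 := hN.symm
        _ = ℓ ^ 2 * 1 := (mul_one _).symm
    have h1 : ℓ ∣ 1 := ⟨Ideal.absNorm J, (Nat.eq_of_mul_eq_mul_left (by positivity) h).symm⟩
    exact hℓ.one_lt.ne' (Nat.dvd_one.1 h1)
  · exfalso
    have h : ℓ ^ 2 * (ℓ * Ideal.absNorm J) = ℓ ^ 2 * 1 := by
      calc ℓ ^ 2 * (ℓ * Ideal.absNorm J) = ℓ ^ 2 * ℓ * Ideal.absNorm J := by ring
        _ = ℓ ^ 2 := hN.symm
        _ = ℓ ^ 2 * 1 := (mul_one _).symm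
    have h1 : ℓ ∣ 1 := ⟨Ideal.absNorm J, (Nat.eq_of_mul_eq_mul_left (by positivity) h).symm⟩
    exact hℓ.one_lt.ne' (Nat.dvd_one.1 h1)
  · exfalso
    have h : ℓ ^ 2 * (ℓ * (ℓ * Ideal.absNorm J)) = ℓ ^ 2 * 1 := by
      calc ℓ ^ 2 * (ℓ * (ℓ * Ideal.absNorm J)) = ℓ ^ 2 * ℓ ^ 2 * Ideal.absNorm J := by ring
        _ = ℓ ^ 2 := hN.symm
        _ = ℓ ^ 2 * 1 := (mul_one _).symm
    have h1 : ℓ ∣ 1 := ⟨ℓ * Ideal.absNorm J, (Nat.eq_of_mul_eq_mul_left (by positivity) h).symm⟩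
    exact hℓ.one_lt.ne' (Nat.dvd_one.1 h1)

/-- **… and both are UNRAMIFIED over `ℓ`: `e(v|ℓ) = 1`** (`(ℓ) = v v' ≤ v` but `(ℓ) ≤ v²` would force `v ∣ v'`).
[folklore] -/
theorem ramificationIdx'_eq_one_of_ne (hK : Module.finrank ℚ K = 2) {ℓ : ℕ} (hℓ : ℓ.Prime)
    (v v' : HeightOneSpectrum (𝓞 K)) (hne : v ≠ v') (hv : (ℓ : 𝓞 K) ∈ v.asIdeal) (hv' : (ℓ : 𝓞 K) ∈ v'.asIdeal) :
    (Ideal.span {(ℓ : ℤ)}).ramificationIdx' v.asIdeal = 1 := by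
  obtain ⟨hfac, -⟩ := span_natCast_eq_mul_of_ne hK hℓ v v' hne hv hv'
  have hmap : Ideal.map (algebraMap ℤ (𝓞 K)) (Ideal.span {(ℓ : ℤ)}) = Ideal.span {(ℓ : 𝓞 K)} := by
    rw [Ideal.map_span, Set.image_singleton, map_natCast]
  refine Ideal.ramificationIdx'_spec ?_ ?_
  · rw [hmap, pow_one]
    exact (Ideal.span_singleton_le_iff_mem _).2 hv
  · rw [hmap, hfac]
    intro h
    have hdvd : v.asIdeal * v.asIdeal ∣ v.asIdeal * v'.asIdeal := by rw [← pow_two]; exact Ideal.dvd_iff_le.2 h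
    have h2 : v.asIdeal ∣ v'.asIdeal := (mul_dvd_mul_iff_left v.ne_bot).1 hdvd
    exact hne (HeightOneSpectrum.ext (v'.isMaximal.eq_of_le v.isPrime.ne_top (Ideal.le_of_dvd h2)).symm)

/-- **A place `v ∋ p` with `(p, π)² = (p)` (`π² = p·w`, `(p, w) = 1`: `p` RAMIFIED in the quadratic field) has
`e(v|p) = 2`.** [folklore] -/
theorem ramificationIdx'_eq_two_of_sq_eq_mul (hK : Module.finrank ℚ K = 2) {p : ℕ} (hp : p.Prime)
    {π w a b : 𝓞 K} (hπ : π ^ 2 = p * w) (hab : a * p + b * w = 1) (v : HeightOneSpectrum (𝓞 K))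
    (hpv : (p : 𝓞 K) ∈ v.asIdeal) : (Ideal.span {(p : ℤ)}).ramificationIdx' v.asIdeal = 2 := by
  have hv := asIdeal_eq_span_pair_of_sq_eq_mul hK hp hπ hab v hpv
  have hsq : v.asIdeal ^ 2 = Ideal.span {(p : 𝓞 K)} := by rw [hv]; exact span_pair_sq_eq_span_of_sq_eq_mul hπ hab
  have hmap : Ideal.map (algebraMap ℤ (𝓞 K)) (Ideal.span {(p : ℤ)}) = Ideal.span {(p : 𝓞 K)} := by
    rw [Ideal.map_span, Set.image_singleton, map_natCast]
  refine Ideal.ramificationIdx'_spec ?_ ?_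
  · rw [hmap, hsq]
  · rw [hmap, ← hsq]
    intro h
    have hdvd : v.asIdeal ^ 3 ∣ v.asIdeal ^ 2 := Ideal.dvd_iff_le.2 h
    have hunit : ¬ IsUnit v.asIdeal := fun hu ↦ v.isPrime.ne_top (Ideal.isUnit_iff.1 hu)
    have := (pow_dvd_pow_iff v.ne_bot hunit).1 hdvd
    omega

/-- **An INERT rational prime: a place `v ∋ ℓ` of norm `ℓ²` in a quadratic field IS `(ℓ)`**, so `ord_v ℓ = 1` and
`e(v|ℓ) = 1`. [folklore] -/
theorem asIdeal_eq_span_of_absNorm_eq_sq (hK : Module.finrank ℚ K = 2) {ℓ : ℕ} (hℓ : ℓ.Prime)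
    (v : HeightOneSpectrum (𝓞 K)) (hv : (ℓ : 𝓞 K) ∈ v.asIdeal) (hN : Ideal.absNorm v.asIdeal = ℓ ^ 2) :
    v.asIdeal = Ideal.span {(ℓ : 𝓞 K)} ∧ v.intValuation (ℓ : 𝓞 K) = WithZero.exp (-1 : ℤ) ∧
      (Ideal.span {(ℓ : ℤ)}).ramificationIdx' v.asIdeal = 1 := by
  obtain ⟨J, hJ⟩ := Ideal.dvd_iff_le.2 ((Ideal.span_singleton_le_iff_mem _).2 hv)
  have hNJ := congrArg Ideal.absNorm hJ
  rw [absNorm_span_natCast, hK, map_mul, hN] at hNJ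
  have hJ1 : Ideal.absNorm J = 1 := by
    have h : ℓ ^ 2 * Ideal.absNorm J = ℓ ^ 2 * 1 := by rw [mul_one]; exact hNJ.symm
    exact Nat.eq_of_mul_eq_mul_left (pow_pos hℓ.pos 2) h
  rw [Ideal.absNorm_eq_one_iff.1 hJ1, Ideal.mul_top] at hJ
  -- `hJ : (ℓ) = v`
  have hunit : ¬ IsUnit v.asIdeal := fun hu ↦ v.isPrime.ne_top (Ideal.isUnit_iff.1 hu)
  have hnot : ¬ (ℓ : 𝓞 K) ∈ v.asIdeal ^ 2 := by
    intro h
    have h' : Ideal.span {(ℓ : 𝓞 K)} ≤ v.asIdeal ^ 2 := (Ideal.span_singleton_le_iff_mem _).2 h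
    rw [hJ] at h'
    have hdvd : v.asIdeal ^ 2 ∣ v.asIdeal ^ 1 := by rw [pow_one]; exact Ideal.dvd_iff_le.2 h'
    have := (pow_dvd_pow_iff v.ne_bot hunit).1 hdvd
    omega
  have hval : v.intValuation (ℓ : 𝓞 K) = WithZero.exp (-1 : ℤ) :=
    intValuation_eq_exp_neg_of_mem_of_notMem v 1 (by rw [pow_one]; exact hv) hnot
  have hmap : Ideal.map (algebraMap ℤ (𝓞 K)) (Ideal.span {(ℓ : ℤ)}) = Ideal.span {(ℓ : 𝓞 K)} := by
    rw [Ideal.map_span, Set.image_singleton, map_natCast]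
  refine ⟨hJ.symm, hval, Ideal.ramificationIdx'_spec ?_ ?_⟩
  · rw [hmap, pow_one, hJ]
  · rw [hmap]
    exact fun h ↦ hnot ((Ideal.span_singleton_le_iff_mem _).1 h)

/-! ### §85b Residues: integers at a place, representatives at a degree-one place, and the two roots of `R̄` -/

omit [NumberField K] in
/-- **`(n : 𝓞 K) ∈ v ⟺ ℓ ∣ n`** for a place `v ∋ ℓ` and an integer `n` (`v ∩ ℤ = ℓℤ`). [folklore] -/
theorem intCast_mem_iff_natCast_dvd {ℓ : ℕ} (hℓ : ℓ.Prime) (v : HeightOneSpectrum (𝓞 K))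
    (hv : (ℓ : 𝓞 K) ∈ v.asIdeal) (n : ℤ) : (n : 𝓞 K) ∈ v.asIdeal ↔ (ℓ : ℤ) ∣ n := by
  constructor
  · intro hn
    by_contra hnd
    obtain ⟨u, w, h⟩ := (Prime.coprime_iff_not_dvd (Nat.prime_iff_prime_int.1 hℓ)).2 hnd
    refine v.isPrime.ne_top ((Ideal.eq_top_iff_one _).2 ?_)
    have h1 : ((u * ℓ + w * n : ℤ) : 𝓞 K) = 1 := by rw [h, Int.cast_one]
    rw [← h1]
    push_cast
    exact v.asIdeal.add_mem (v.asIdeal.mul_mem_left _ hv) (v.asIdeal.mul_mem_left _ hn)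
  · rintro ⟨m, rfl⟩
    push_cast
    exact v.asIdeal.mul_mem_right _ hv

/-- **At a place of PRIME norm `ℓ` every algebraic integer is congruent to a rational integer** (`𝓞_K/v ≅ 𝔽_ℓ`).
[folklore] -/
theorem exists_sub_intCast_mem_of_absNorm_eq (v : HeightOneSpectrum (𝓞 K)) {ℓ : ℕ} (hℓ : ℓ.Prime)
    (hN : Ideal.absNorm v.asIdeal = ℓ) (x : 𝓞 K) : ∃ r : ℤ, x - r ∈ v.asIdeal := by
  classical
  haveI : Finite (𝓞 K ⧸ v.asIdeal) := v.asIdeal.finiteQuotientOfFreeOfNeBot v.ne_bot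
  letI : Fintype (𝓞 K ⧸ v.asIdeal) := Fintype.ofFinite _
  haveI : NeZero ℓ := ⟨hℓ.ne_zero⟩
  have hcard : Fintype.card (𝓞 K ⧸ v.asIdeal) = ℓ := by rw [card_quotient_eq_absNorm, hN]
  let e := ZMod.ringEquivOfPrime (𝓞 K ⧸ v.asIdeal) hℓ hcard
  refine ⟨((e.symm (Ideal.Quotient.mk v.asIdeal x)).val : ℤ), ?_⟩
  rw [← Ideal.Quotient.eq, map_intCast]
  have h1 : (((e.symm (Ideal.Quotient.mk v.asIdeal x)).val : ℤ) : 𝓞 K ⧸ v.asIdeal) =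
      e ((((e.symm (Ideal.Quotient.mk v.asIdeal x)).val : ℤ) : ZMod ℓ)) := by rw [map_intCast]
  rw [h1, Int.cast_natCast, ZMod.natCast_zmod_val, RingEquiv.apply_symm_apply]

/-- In a field, if `x·y` is a NON-ZERO square then `x` is a square iff `y` is. [folklore] -/
theorem isSquare_iff_isSquare_of_mul_eq_sq {k : Type*} [Field k] {x y s : k} (h : x * y = s ^ 2) (hs : s ≠ 0) :
    IsSquare x ↔ IsSquare y := by
  have hx : x ≠ 0 := fun h0 ↦ by rw [h0, zero_mul] at h; exact hs (pow_eq_zero_iff two_ne_zero |>.1 h.symm)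
  have hy : y ≠ 0 := fun h0 ↦ by rw [h0, mul_zero] at h; exact hs (pow_eq_zero_iff two_ne_zero |>.1 h.symm)
  constructor
  · rintro ⟨a, ha⟩
    have ha0 : a ≠ 0 := by rintro rfl; exact hx (by rw [ha, mul_zero])
    exact ⟨s / a, by field_simp; rw [← h, ha]; ring⟩
  · rintro ⟨a, ha⟩
    have ha0 : a ≠ 0 := by rintro rfl; exact hy (by rw [ha, mul_zero])
    exact ⟨s / a, by field_simp; rw [← h, ha]; ring⟩

/-- **THE RESIDUES OF `θ` AT TWO DEGREE-ONE PLACES OVER `ℓ` ARE THE TWO ROOTS OF `R̄`, WHOSE PRODUCT IS `q̄`**: if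
`θ + θ' = -p`, `θθ' = q = s₀²` in `𝓞_K` (so `q` is a square — the CYCLIC quartic CM fields) and `v, v' ∋ ℓ ∤ q` have
norm `ℓ`, then `θ` is a square mod `v` iff it is a square mod `v'` (an integer representative `r` of `θ mod v'` is a
root of `R̄`, hence `≡ θ` or `≡ θ'` mod `v`; in the second case use `θ̄·θ̄' = s̄₀² ≠ 0`). [folklore] -/
theorem isSquare_residue_iff_of_mul_eq_sq {θₒ θ' s₀ : 𝓞 K} {p q : ℤ} (hsum : θₒ + θ' = -p)
    (hprod : θₒ * θ' = q) (hs : s₀ ^ 2 = q) {ℓ : ℕ} (hℓ : ℓ.Prime) (v v' : HeightOneSpectrum (𝓞 K))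
    (hN : Ideal.absNorm v.asIdeal = ℓ) (hN' : Ideal.absNorm v'.asIdeal = ℓ)
    (hv : (ℓ : 𝓞 K) ∈ v.asIdeal) (hv' : (ℓ : 𝓞 K) ∈ v'.asIdeal) (hqv : (q : 𝓞 K) ∉ v.asIdeal) :
    IsSquare (Ideal.Quotient.mk v.asIdeal θₒ) ↔ IsSquare (Ideal.Quotient.mk v'.asIdeal θₒ) := by
  obtain ⟨r, hr⟩ := exists_sub_intCast_mem_of_absNorm_eq v' hℓ hN' θₒ
  have hRr : ((r ^ 2 + p * r + q : ℤ) : 𝓞 K) = (θₒ - r) * (θ' - r) := by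
    push_cast
    linear_combination (r : 𝓞 K) * hsum - hprod
  -- `R(r) ∈ v'`, hence `ℓ ∣ R(r)`, hence `R(r) ∈ v`
  have h1 : ((r ^ 2 + p * r + q : ℤ) : 𝓞 K) ∈ v'.asIdeal := by
    rw [hRr]; exact v'.asIdeal.mul_mem_right _ hr
  have h2 : ((r ^ 2 + p * r + q : ℤ) : 𝓞 K) ∈ v.asIdeal :=
    (intCast_mem_iff_natCast_dvd hℓ v hv _).2 ((intCast_mem_iff_natCast_dvd hℓ v' hv' _).1 h1)
  rw [hRr] at h2
  have er' : Ideal.Quotient.mk v'.asIdeal θₒ = Ideal.Quotient.mk v'.asIdeal (r : 𝓞 K) := Ideal.Quotient.eq.2 hr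
  rcases v.isPrime.mem_or_mem h2 with h3 | h3
  · -- `θ ≡ r` at both places
    rw [Ideal.Quotient.eq.2 h3, er', isSquare_intCast_residue_iff_of_absNorm_eq v hℓ hN,
      isSquare_intCast_residue_iff_of_absNorm_eq v' hℓ hN']
  · -- `θ' ≡ r (mod v)`: `θ̄ θ̄' = s̄₀²`
    haveI : v.asIdeal.IsMaximal := v.isMaximal
    letI : Field (𝓞 K ⧸ v.asIdeal) := Ideal.Quotient.field v.asIdeal
    have hs0 : Ideal.Quotient.mk v.asIdeal s₀ ≠ 0 := by
      intro h0
      rw [Ideal.Quotient.eq_zero_iff_mem] at h0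
      exact hqv (by rw [← hs, pow_two]; exact v.asIdeal.mul_mem_left _ h0)
    have hmul : Ideal.Quotient.mk v.asIdeal θₒ * Ideal.Quotient.mk v.asIdeal θ' = (Ideal.Quotient.mk v.asIdeal s₀) ^ 2 := by
      rw [← map_mul, ← map_pow, hprod, hs]
    rw [isSquare_iff_isSquare_of_mul_eq_sq hmul hs0, Ideal.Quotient.eq.2 h3, er',
      isSquare_intCast_residue_iff_of_absNorm_eq v hℓ hN, isSquare_intCast_residue_iff_of_absNorm_eq v' hℓ hN']

end Toolkit

end Summit.HodgeConjecture.HodgeConjecture.Ring2.WeilCoverageCM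

end
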